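import Literature.NumberTheory.Automorphic.ArchDiagonalTorusCentralizer        -- ★ D1′b₃ (p06): `centralizer_archDiagTorus_eq_range`, `archDiagTorus_mul_comm`
import Literature.NumberTheory.Automorphic.TorusNormalisedCentralizerMeasures   -- ★ (V2-meas, generic): `exists_isQuotientOf_of_torusHaar`
import Literature.NumberTheory.Automorphic.UnitaryGroupArchTopology             -- ★ instances on `↥arch` (topological group, locally compact, second countable, T₂)
import HarnessLib

/-!
# The torus-normalised orbital-measure family of `G′_∞ = U(diag α)(L⁺ ⊗ ℝ)` along its diagonal circle torus (road D1′ ∕ «D2′a», (V2) GLOBAL; Rogawski 1990 §1.7, §4.3, §8.2)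

Topic `NumberTheory/Automorphic`; namespace `Literature.NumberTheory.Automorphic.UnitaryGroup`.  THEOREMS ONLY (no definition, no named fact, no instance, no
notation, no `sorry`).  Cell `hodgecm-mathlib`, floor-1 prep under #88 (ST-∞) ∕ #111 (S-d): the GLOBAL twin of ★ `ArchLocalTorusNormalisedFamily`
(`exists_isQuotientOf_circleTorus`, per place) — on the WHOLE archimedean group `U(diag α)(L⁺ ⊗ ℝ) = ∏_w U(σ_w diag α)(ℂ)` (★ `UnitaryGroup.arch`, the group
★ `archStableOrbitalIntegral` and the (ST-∞) clause of ★ `SingularEllipticTransferCanonical` live on), with the diagonal torus of ★ D1′b `archDiagTorus L N α`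
and p06's ★ `centralizer_archDiagTorus_eq_range` («`Z(t(z)) = T` for `z` placewise injective»): ONE Haar measure `t_T` on `T = range (archDiagTorus L N α)`
normalises the orbit measures at EVERY regular torus point — Weil form `dν ∕ dt_T` (★ `OrbitalMeasureFamily.IsQuotientOf`) — the normalisation of
Harish-Chandra's `F_f` and of the «`γ → γ₀` through `T_reg`» limits ([Rogawski1990] §8.2 pp. 122–124, §14.5 p. 238).

* **`UnitaryGroup.exists_isQuotientOf_archDiagTorus`**.

JUNK AUDIT: `hα : ∀ i, α i ≠ 0` (non-degenerate diagonal form) is what `Z(t(z)) = T` needs; `ν` right-invariant and finite on compacta (★ `IsQuotientOf`'s frame; every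
Haar measure of the unimodular `U(diag α)(L⁺ ⊗ ℝ)` qualifies — ★ `modularCharacterFun_arch_eq_one` elsewhere, not needed here); the quotient σ-algebras are section
hypotheses (`borel` at use) as in ★ `ArchCentralizerHaarMeasures`; off the regular torus classes the family is unspecified (`0`), never read.
HONEST LABEL: HC_CM is proved only modulo the printed citations until rung 0 closes; count-neutral floor-1 preparation.

## References
* J. D. Rogawski, *Automorphic Representations of Unitary Groups in Three Variables*, Ann. of Math. Stud. 123 (1990), §1.7 p. 6, §4.3 (4.3.1) p. 43, §8.2 pp. 122–124,
  §14.5 p. 238 [Rogawski1990].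
* A. Deitmar, S. Echterhoff, *Principles of Harmonic Analysis*, 2nd ed. (2014), Thm. 1.5.3 [DeitmarEchterhoff2014].
-/

set_option autoImplicit false

noncomputable section

open MeasureTheory Measure NumberField NumberField.InfinitePlace
open scoped MatrixGroups

namespace Literature.NumberTheory.Automorphic

namespace UnitaryGroup

variable (L : Type) [Field L] [NumberField L] [IsCMField L] (N : ℕ) (α : Fin N → L)

/-- **THE TORUS-NORMALISED ORBITAL-MEASURE FAMILY OF `U(diag α)(L⁺ ⊗ ℝ)`**: for ONE Haar measure `t_T` on the diagonal circle torus `T = range (archDiagTorus L N α)`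
and a right-invariant measure `ν` on `G′_∞ = U(diag α)(L⁺ ⊗ ℝ)` (finite on compacta) there are centraliser measures `t` with `t (t(z)) = t_T.map (T = Z(t(z)))`
at every regular torus point (`z` injective at every complex place; ★ `centralizer_archDiagTorus_eq_range`) and an orbital-measure family `m` with ★
`OrbitalMeasureFamily.IsQuotientOf P ν t m`, `P γ := ∃ z, (∀ w, Injective (z w)) ∧ γ = archDiagTorus L N α z` — Weil form `m ⟦t(z)⟧ = dν ∕ dt_T`; each `t (t(z))` an
inversion-invariant Haar measure of the torus `Z(t(z)) = T`. [cite: Rogawski1990, §1.7 p. 6; §4.3 (4.3.1) p. 43; §8.2 p. 122] [cite: DeitmarEchterhoff2014, Thm. 1.5.3] -/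
theorem exists_isQuotientOf_archDiagTorus (hα : ∀ i, α i ≠ 0)
    [MeasurableSpace (arch (↥(maximalRealSubfield L)) L (IsCMField.complexConj L) N (Matrix.diagonal α))]
    [BorelSpace (arch (↥(maximalRealSubfield L)) L (IsCMField.complexConj L) N (Matrix.diagonal α))]
    [∀ γ : arch (↥(maximalRealSubfield L)) L (IsCMField.complexConj L) N (Matrix.diagonal α),
      MeasurableSpace (arch (↥(maximalRealSubfield L)) L (IsCMField.complexConj L) N (Matrix.diagonal α) ⧸
        Subgroup.centralizer ({γ} : Set (arch (↥(maximalRealSubfield L)) L (IsCMField.complexConj L) N (Matrix.diagonal α))))]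
    [∀ γ : arch (↥(maximalRealSubfield L)) L (IsCMField.complexConj L) N (Matrix.diagonal α),
      BorelSpace (arch (↥(maximalRealSubfield L)) L (IsCMField.complexConj L) N (Matrix.diagonal α) ⧸
        Subgroup.centralizer ({γ} : Set (arch (↥(maximalRealSubfield L)) L (IsCMField.complexConj L) N (Matrix.diagonal α))))]
    (ν : Measure (arch (↥(maximalRealSubfield L)) L (IsCMField.complexConj L) N (Matrix.diagonal α)))
    [IsFiniteMeasureOnCompacts ν] [ν.IsMulRightInvariant]
    (tT : Measure ↥((archDiagTorus L N α).range)) [tT.IsHaarMeasure] :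
    ∃ (t : ∀ γ : arch (↥(maximalRealSubfield L)) L (IsCMField.complexConj L) N (Matrix.diagonal α),
          Measure (Subgroup.centralizer ({γ} : Set (arch (↥(maximalRealSubfield L)) L (IsCMField.complexConj L) N (Matrix.diagonal α)))))
      (m : OrbitalMeasureFamily (arch (↥(maximalRealSubfield L)) L (IsCMField.complexConj L) N (Matrix.diagonal α))),
      (∀ (z : {w : InfinitePlace L // IsComplex w} → Fin N → Circle) (hz : ∀ w, Function.Injective (z w)),
        t (archDiagTorus L N α z) = tT.map (MulEquiv.subgroupCongr (centralizer_archDiagTorus_eq_range L N α hα hz).symm)) ∧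
      m.IsQuotientOf
        (fun γ => ∃ z : {w : InfinitePlace L // IsComplex w} → Fin N → Circle, (∀ w, Function.Injective (z w)) ∧ γ = archDiagTorus L N α z)
        ν t := by
  -- `T = Z(γ)` and commutativity of `Z(γ)` at the regular torus points (p06's ★ D1′b₃)
  have hP : ∀ γ : arch (↥(maximalRealSubfield L)) L (IsCMField.complexConj L) N (Matrix.diagonal α),
      (∃ z : {w : InfinitePlace L // IsComplex w} → Fin N → Circle, (∀ w, Function.Injective (z w)) ∧ γ = archDiagTorus L N α z) →
        (archDiagTorus L N α).range =
          Subgroup.centralizer ({γ} : Set (arch (↥(maximalRealSubfield L)) L (IsCMField.complexConj L) N (Matrix.diagonal α))) := by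
    rintro γ ⟨z, hz, rfl⟩
    exact (centralizer_archDiagTorus_eq_range L N α hα hz).symm
  have hcomm : ∀ γ : arch (↥(maximalRealSubfield L)) L (IsCMField.complexConj L) N (Matrix.diagonal α),
      (∃ z : {w : InfinitePlace L // IsComplex w} → Fin N → Circle, (∀ w, Function.Injective (z w)) ∧ γ = archDiagTorus L N α z) →
        ∀ a ∈ Subgroup.centralizer ({γ} : Set (arch (↥(maximalRealSubfield L)) L (IsCMField.complexConj L) N (Matrix.diagonal α))),
          ∀ b ∈ Subgroup.centralizer ({γ} : Set (arch (↥(maximalRealSubfield L)) L (IsCMField.complexConj L) N (Matrix.diagonal α))),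
            a * b = b * a := by
    rintro γ ⟨z, hz, rfl⟩ a ha b hb
    rw [centralizer_archDiagTorus_eq_range L N α hα hz] at ha hb
    obtain ⟨za, rfl⟩ := ha
    obtain ⟨zb, rfl⟩ := hb
    exact archDiagTorus_mul_comm L N α za zb
  obtain ⟨t, m, ht, hm⟩ := exists_isQuotientOf_of_torusHaar ν _ tT _ hP hcomm
  exact ⟨t, m, fun z hz => ht _ ⟨z, hz, rfl⟩, hm⟩

end UnitaryGroup

end Literature.NumberTheory.Automorphic

end
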